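import Summits.BirchSwinnertonDyer.BirchSwinnertonDyer.Theorems.BiquadraticEisensteinDescentEisensteinHeartFlatCMInertBadKPrimeKatzHsiehLValueCM
import Mathlib.NumberTheory.NumberField.Norm
import Mathlib.Tactic.ComputeDegree
import HarnessLib

set_option linter.dupNamespace false -- `Summit.BirchSwinnertonDyer.BirchSwinnertonDyer.Theorems.…` (summit = sub)
set_option autoImplicit false

/-!
# Crux `EisensteinHeartFlatCMInertBadKPrime` (stmt-BirchSwinnertonDyer-21341), line `hsieh-lambda`, layer 2 (V2), hypothesis (L):
# the CM-field element `θ₀ = (1 + √d)/2` and its two prime-avoidance properties, for `d ≡ 1 (mod 4)` with `|d|` prime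

Route `BiquadraticEisensteinDescent` (cell `pub/bsd-wall`, width seat `bsd-wall-cm-bed-w3`). THEOREMS ONLY (no definition, no named
fact, no `sorry`); supports stmt-BirchSwinnertonDyer-21341 as a helper; nothing about the crux's input or any case of BSD is asserted.

`…KatzHsiehLValueCM.hLval_of_deuring_of_cmField` asks for `θ₀ ∈ 𝓞 K₁`, `a ∈ ℤ` with `c • θ₀ = a − θ₀` and two statements about the
primes of `K₁` containing `a − 2θ₀`. For the SEVEN CM fields `ℚ(√d)`, `d ∈ {−3, −7, −11, −19, −43, −67, −163}` (`d ≡ 1 (mod 4)`, `|d|`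
prime) this file supplies them (`exists_cmElement`) from an element `y ∈ 𝓞 K₁` with `y² = d` and `c • y = −y` (the frame package of width
seat w1: `K₁ = ℚ⟮x⟯ ⊂ L`, `x² = d_CM`, `τ x = −x`): `θ₀ = (1 + y)/2` (a root of `X² − X + (1−d)/4`), `a = 1`, `a − 2θ₀ = −y`; a prime
`𝔮 ∋ y` has `N(𝔮) ∣ |N(y)| = |d|` prime, so `N(𝔮) = |d|` is not a square (first statement) and the rational prime below `𝔮` is `ℓ = |d|`,
an ODD prime dividing `d` (second statement, to be combined with `Rank1Residual…not_good_of_dvd_cmFieldDiscrOfJ`: `ℓ ∣ d_CM`, `ℓ ≠ 2 ⇒`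
bad). The two remaining fields `ℚ(i)`, `ℚ(√−2)` (`j = 1728, 8000`) need `θ₀ = y/2` instead and are not treated here.

References: [NeukirchANT1999] Ch. I §2 (integers of quadratic fields), §8; [SilvermanATAEC1994] App. A §3.
-/

noncomputable section

open scoped NumberField Polynomial
open NumberField IsDedekindDomain Ideal Polynomial
open Literature.NumberTheory.Automorphic

namespace Summit.BirchSwinnertonDyer.BirchSwinnertonDyer.Theorems.BiquadraticEisensteinDescentEisensteinHeartFlatCMInertBadKPrimeDeuringOverKPrimeCMElement

variable {K₁ : Type} [Field K₁] [NumberField K₁]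

/-- `(1 + y)/2` is an algebraic integer when `y² = d ≡ 1 (mod 4)`: it is a root of `X² − X + (1 − d)/4`.
[cite: NeukirchANT1999, Ch. I §2 (Prop. 2.4 proof)] -/
theorem isIntegral_one_add_div_two {y : K₁} {d : ℤ} (hy : y ^ 2 = d) (hd4 : d % 4 = 1) :
    IsIntegral ℤ ((1 + y) / 2) := by
  obtain ⟨k, hk⟩ : ∃ k : ℤ, d = 4 * k + 1 := ⟨d / 4, by omega⟩
  refine ⟨X ^ 2 - X - C k, by monicity!, ?_⟩
  rw [eval₂_sub, eval₂_sub, eval₂_pow, eval₂_X, eval₂_C, algebraMap_int_eq, eq_intCast]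
  have hd : (d : K₁) = 4 * k + 1 := by rw [hk]; push_cast; ring
  rw [hd] at hy
  linear_combination (1 / 4 : K₁) * hy

/-- **The CM element `θ₀ = (1 + √d)/2` for `d ≡ 1 (mod 4)`, `|d|` prime.** Given `y ∈ 𝓞 K₁` with `y² = d`, `c • y = −y` (`c ∈ Gal(K₁/ℚ)`),
`[K₁:ℚ] = 2`: there is `θ₀ ∈ 𝓞 K₁` with (i) `c • θ₀ = 1 − θ₀`; (ii) `1 − 2θ₀ ∉ 𝔮` for every prime `𝔮` with `N(𝔮) = ℓ²` (`ℓ = N(𝔮).minFac`);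
(iii) if `ℓ ∈ 𝔮` and `1 − 2θ₀ ∈ 𝔮` then `ℓ ∣ d` and `ℓ ≠ 2`. These are the hypotheses `hcθ`, `hθ`, and (with «`ℓ ∣ d_CM`, `ℓ ≠ 2 ⇒` bad»)
`hθram` of `…KatzHsiehLValueCM.hLval_of_deuring_of_cmField` with `a = 1`. [cite: NeukirchANT1999, Ch. I §2 and §8 (8.3)]
[cite: SilvermanATAEC1994, App. A §3 (first table)] -/
theorem exists_cmElement (h2 : Module.finrank ℚ K₁ = 2) (c : K₁ ≃ₐ[ℚ] K₁) {y : 𝓞 K₁} {d : ℤ}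
    (hy : ((y : K₁)) ^ 2 = d) (hcy : c • y = -y) (hd4 : d % 4 = 1) (hdp : d.natAbs.Prime) :
    ∃ θ₀ : 𝓞 K₁, c • θ₀ = ((1 : ℤ) : 𝓞 K₁) - θ₀ ∧
      (∀ 𝔮 : HeightOneSpectrum (𝓞 K₁), Ideal.absNorm 𝔮.asIdeal = (Ideal.absNorm 𝔮.asIdeal).minFac ^ 2 →
        ((1 : ℤ) : 𝓞 K₁) - 2 * θ₀ ∉ 𝔮.asIdeal) ∧
      (∀ (ℓ : ℕ) [Fact ℓ.Prime] (𝔮 : HeightOneSpectrum (𝓞 K₁)), (ℓ : 𝓞 K₁) ∈ 𝔮.asIdeal →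
        ((1 : ℤ) : 𝓞 K₁) - 2 * θ₀ ∈ 𝔮.asIdeal → (ℓ : ℤ) ∣ d ∧ ℓ ≠ 2) := by
  -- the element
  set θ₀ : 𝓞 K₁ := ⟨(1 + (y : K₁)) / 2, isIntegral_one_add_div_two hy hd4⟩ with hθ₀
  have hθ₀K : algebraMap (𝓞 K₁) K₁ θ₀ = (1 + (y : K₁)) / 2 := rfl
  have hyK : algebraMap (𝓞 K₁) K₁ y = (y : K₁) := rfl
  have h12 : ((1 : ℤ) : 𝓞 K₁) - 2 * θ₀ = -y := by
    apply RingOfIntegers.ext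
    show algebraMap (𝓞 K₁) K₁ (((1 : ℤ) : 𝓞 K₁) - 2 * θ₀) = algebraMap (𝓞 K₁) K₁ (-y)
    rw [map_sub, map_mul, map_intCast, map_ofNat, map_neg, hθ₀K, hyK]
    push_cast
    ring
  -- the norm of `y`: `N(y)² = N(d) = d²`, so `|N(y)| = |d|`
  have hy' : y ^ 2 = ((d : ℤ) : 𝓞 K₁) := by
    apply RingOfIntegers.ext
    show algebraMap (𝓞 K₁) K₁ (y ^ 2) = algebraMap (𝓞 K₁) K₁ ((d : ℤ) : 𝓞 K₁)
    rw [map_pow, map_intCast, hyK, hy]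
  have hNy : (Algebra.norm ℤ y).natAbs = d.natAbs := by
    have h1 : Algebra.norm ℤ y ^ 2 = d ^ 2 := by
      rw [← map_pow, hy', show ((d : ℤ) : 𝓞 K₁) = algebraMap ℤ (𝓞 K₁) d from rfl, Algebra.norm_algebraMap,
        RingOfIntegers.rank, h2]
    exact Int.natAbs_eq_iff_sq_eq.mpr h1
  -- a prime containing `y` has norm `|d|`
  have hN𝔮 : ∀ 𝔮 : HeightOneSpectrum (𝓞 K₁), y ∈ 𝔮.asIdeal → Ideal.absNorm 𝔮.asIdeal = d.natAbs := by
    intro 𝔮 hmem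
    have h1 : Ideal.absNorm 𝔮.asIdeal ∣ d.natAbs := by
      rw [← hNy]
      exact Int.ofNat_dvd_left.mp (Ideal.absNorm_dvd_norm_of_mem hmem)
    have hne1 : Ideal.absNorm 𝔮.asIdeal ≠ 1 := fun h ↦ 𝔮.isPrime.ne_top (Ideal.absNorm_eq_one_iff.mp h)
    rcases (Nat.dvd_prime hdp).mp h1 with h | h
    · exact absurd h hne1
    · exact h
  refine ⟨θ₀, ?_, ?_, ?_⟩
  · -- (i) `c • θ₀ = 1 − θ₀`
    apply RingOfIntegers.ext
    have hcyK : c (y : K₁) = -(y : K₁) := by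
      have h := congrArg (algebraMap (𝓞 K₁) K₁) hcy
      rw [map_neg, hyK] at h
      exact h
    rw [RingOfIntegers.coe_algEquiv_smul]
    show c (algebraMap (𝓞 K₁) K₁ θ₀) = algebraMap (𝓞 K₁) K₁ (((1 : ℤ) : 𝓞 K₁) - θ₀)
    rw [map_sub, map_intCast, hθ₀K, map_div₀, map_add, map_one, map_ofNat, hcyK]
    push_cast
    ring
  · -- (ii) `N(𝔮) = |d|` is prime, not a square
    intro 𝔮 hsq hmem
    rw [h12, neg_mem_iff] at hmem
    have hN := hN𝔮 𝔮 hmem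
    rw [hN, hdp.minFac_eq] at hsq
    nlinarith [hdp.one_lt]
  · -- (iii) the rational prime below is `ℓ = |d|`, odd, dividing `d`
    intro ℓ _ 𝔮 hℓ hmem
    rw [h12, neg_mem_iff] at hmem
    have hN := hN𝔮 𝔮 hmem
    have hℓp : ℓ.Prime := Fact.out
    -- `N(𝔮) ∣ N(ℓ) = ℓ²`
    have h1 : Ideal.absNorm 𝔮.asIdeal ∣ ℓ ^ 2 := by
      have h := Ideal.absNorm_dvd_absNorm_of_le ((Ideal.span_singleton_le_iff_mem _).mpr hℓ)
      rwa [Ideal.absNorm_span_natCast, RingOfIntegers.rank, h2] at h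
    rw [hN] at h1
    have h2' : d.natAbs ∣ ℓ := hdp.dvd_of_dvd_pow h1
    have h3 : d.natAbs = ℓ := ((Nat.dvd_prime hℓp).mp h2').resolve_left hdp.one_lt.ne'
    refine ⟨Int.ofNat_dvd_left.mpr (by rw [h3]), by omega⟩

end Summit.BirchSwinnertonDyer.BirchSwinnertonDyer.Theorems.BiquadraticEisensteinDescentEisensteinHeartFlatCMInertBadKPrimeDeuringOverKPrimeCMElement

end
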